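import Summits.BirchSwinnertonDyer.BirchSwinnertonDyer.Theorems.UniversalToricDescentEisensteinSplitControl
import Literature.NumberTheory.EllipticCurves.IwasawaAlgebraSpecializationCountProofs
import Literature.NumberTheory.EllipticCurves.ZpExtensionScalarTwist

/-!
# Eisenstein split control in the tree's `Λ` / `S_m` / `A_{m,k}` vocabulary:
# `#(Λ/(q_m, (1+T)^{p^s} − 1)) = #(S_m/(Ψ(γ^{p^s}) − 1)) = #(A_{m,k}/((1+T)^{p^s} − 1)) = p^{p^s}` for `p^s ≤ m`, `k ≥ 1`

Support algebra for the crux `TwinAlgMuZeroAtThree` (stmt-BirchSwinnertonDyer-24737, R2 text; line `beta-road` v5, K2_res),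
Eisenstein-prime road of `bsd-wall-utd-idea` g62 (`Cruxes/TwinAlgMuZeroAtThree/Ideas/eisenstein-prime-road.md`, LENS-MEMO §6 (iv),
sub-stub [R2]: uniform local control at a SPLIT multiplicative `v ∣ p`).  Width prover `bsd-wall-utd-p1-w2` g10,
`--supports stmt-BirchSwinnertonDyer-24737`; sequel of `…Theorems.UniversalToricDescentEisensteinSplitControl` (p745020), which
did the computation in `ℤ_p[X]`.  Here the SAME count is transported to the objects the tree's Howard-2004 engine actually uses
(cell `pub/bsd-print-x9`): `Λ = IwasawaAlgebra p = ℤ_p⟦T⟧`, Howard's Eisenstein primes `q_m = T^m + p`, the specialised DVR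
`S_m = Λ/(q_m)` (`…IwasawaAlgebraEisensteinQuotientDVRProofs`), the universal character `Ψ(γ) = 1 + T`
(`IwasawaAlgebra.EisensteinCoeff.onePlusT`), and the finite coefficient rings `A_{m,k} = Λ/(q_m, p^k)` (`IwasawaAlgebra.EisensteinCoeff`).

* §1 `lambda_span_qm_pair_eq` : `(q_m, (1+T)^{p^s} − 1) = (p, T^{p^s})` in `Λ` for `p^s ≤ m` (Nakayama step = p745020's
  `pow_prime_pow_eq_zero`, applied to the module-finite `ℤ_p`-algebra `Λ/(q_m, ·)`);
* §2 `natCard_lambda_quotient_span_C_X_pow` : `#(Λ/(p, T^k)) = p^k` (`k ≥ 1`; = `#A_{k,1}`, tree `card_quotient_span_qm_sup_span_C_pow`);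
* §3 `natCard_lambda_quotient_eisenstein_split_control` : `#(Λ/(q_m, (1+T)^{p^s} − 1)) = p^{p^s}`;
* §4 `natCard_specialization_quotient_onePlusPi_pow_sub_one` : `#(S_m/((1+π)^{p^s} − 1)) = p^{p^s}` — Howard's term (iv)
  `D_𝔮[Ψ(γ^{p^s}) − 1]`-sized module at a split multiplicative place of decomposition index `p^s`, EXACT and independent of `m ≥ p^s`;
* §5 `natCard_eisensteinCoeff_quotient_onePlusT_pow_sub_one` : `#(A_{m,k}/((1+T)^{p^s} − 1)) = p^{p^s}` for every `k ≥ 1` —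
  the equality case (`n₀ = 1`, and also the boundary `m = p^s`) of x9's anomalous-graded bound
  `EisensteinCoeff.natCard_quotient_span_intCast_mul_onePlusT_pow_sub_one_le` (`≤ p^{p^s}` for `p ∤ n₀`, `p^s < m`).

THEOREMS ONLY (no definition, no named fact, no `sorry`; axioms standard).  BSD is proved for no curve by this file; 24737 OPEN.
-/

noncomputable section

-- `Summit.BirchSwinnertonDyer.BirchSwinnertonDyer.…` is the tree's layout (summit = problem), not a typo.
set_option linter.dupNamespace false

namespace Summit.BirchSwinnertonDyer.BirchSwinnertonDyer.Theorems.UniversalToricDescentEisensteinSplitControl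

open Literature.NumberTheory.EllipticCurves

variable (p : ℕ) [hp : Fact p.Prime]

/-! ## §1 The ideal identity in `Λ` -/

/-- `Λ/(q_m, h)` is a finitely generated `ℤ_p`-module for `m ≥ 1` (quotient of `S_m = Λ/(q_m) ≅ ℤ_p^m`). -/
theorem moduleFinite_lambda_quotient_span_qm_pair {m : ℕ} (hm : 1 ≤ m) (h : IwasawaAlgebra p) :
    Module.Finite ℤ_[p] (IwasawaAlgebra p ⧸
      Ideal.span {(PowerSeries.X ^ m + PowerSeries.C (p : ℤ_[p]) : IwasawaAlgebra p), h}) := by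
  have hq := IwasawaAlgebra.isDistinguishedAt_X_pow_add_C p hm
  have hfin := finite_quotient_pow p hq 1
  rw [pow_one, IwasawaAlgebra.coe_X_pow_add_C] at hfin
  have hle : Ideal.span {(PowerSeries.X ^ m + PowerSeries.C (p : ℤ_[p]) : IwasawaAlgebra p)}
      ≤ Ideal.span {(PowerSeries.X ^ m + PowerSeries.C (p : ℤ_[p]) : IwasawaAlgebra p), h} :=
    Ideal.span_mono (by simp)
  exact Module.Finite.of_surjective (Ideal.Quotient.factorₐ ℤ_[p] hle).toLinearMap
    (Ideal.Quotient.factor_surjective hle)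

/-- **The ideal identity in `Λ`.**  For `p^s ≤ m`: `(T^m + p, (1+T)^{p^s} − 1) = (p, T^{p^s})` in `Λ = ℤ_p⟦T⟧`. -/
theorem lambda_span_qm_pair_eq (s m : ℕ) (hm : p ^ s ≤ m) :
    Ideal.span {(PowerSeries.X ^ m + PowerSeries.C (p : ℤ_[p]) : IwasawaAlgebra p),
        (1 + PowerSeries.X) ^ (p ^ s) - 1}
      = Ideal.span {PowerSeries.C (p : ℤ_[p]), (PowerSeries.X : IwasawaAlgebra p) ^ (p ^ s)} := by
  have hp' : p.Prime := hp.out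
  set k := p ^ s with hk
  have hk1 : 1 ≤ k := hk ▸ Nat.one_le_pow _ _ hp'.pos
  have hm1 : 1 ≤ m := le_trans hk1 hm
  set q : IwasawaAlgebra p := PowerSeries.X ^ m + PowerSeries.C (p : ℤ_[p]) with hqdef
  set I : Ideal (IwasawaAlgebra p) := Ideal.span {q, (1 + PowerSeries.X) ^ k - 1} with hI
  set J : Ideal (IwasawaAlgebra p) :=
    Ideal.span {PowerSeries.C (p : ℤ_[p]), (PowerSeries.X : IwasawaAlgebra p) ^ k} with hJ
  have hCp : (PowerSeries.C (p : ℤ_[p]) : IwasawaAlgebra p) = (p : IwasawaAlgebra p) := map_natCast _ p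
  apply le_antisymm
  · -- `I ≤ J`
    rw [Ideal.span_le]
    rintro f hf
    simp only [Set.mem_insert_iff, Set.mem_singleton_iff] at hf
    have hpJ : (PowerSeries.C (p : ℤ_[p]) : IwasawaAlgebra p) ∈ J := Ideal.subset_span (by simp)
    have hXJ : ((PowerSeries.X : IwasawaAlgebra p) ^ k) ∈ J := Ideal.subset_span (by simp)
    rcases hf with rfl | rfl
    · have hXm : ((PowerSeries.X : IwasawaAlgebra p) ^ m) = PowerSeries.X ^ (m - k) * PowerSeries.X ^ k := by
        rw [← pow_add, Nat.sub_add_cancel hm]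
      rw [hqdef, hXm]
      exact J.add_mem (J.mul_mem_left _ hXJ) hpJ
    · obtain ⟨r, hr⟩ := exists_add_pow_prime_pow_eq hp' (1 : IwasawaAlgebra p) PowerSeries.X s
      rw [← hk] at hr
      have : ((1 + PowerSeries.X) ^ k - 1 : IwasawaAlgebra p)
          = PowerSeries.X ^ k + PowerSeries.C (p : ℤ_[p]) * (PowerSeries.X * r) := by
        rw [hr, hCp]; ring
      rw [this]
      exact J.add_mem hXJ (J.mul_mem_right _ hpJ)
  · -- `J ≤ I`: Nakayama in `A = Λ/I` (p745020 `pow_prime_pow_eq_zero`)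
    haveI : Module.Finite ℤ_[p] (IwasawaAlgebra p ⧸ I) := moduleFinite_lambda_quotient_span_qm_pair p hm1 _
    set x : IwasawaAlgebra p ⧸ I := Ideal.Quotient.mk I PowerSeries.X with hxdef
    have hgI : q ∈ I := Ideal.subset_span (by simp)
    have hhI : ((1 + PowerSeries.X) ^ k - 1 : IwasawaAlgebra p) ∈ I := Ideal.subset_span (by simp)
    have hx : x ^ m + (p : IwasawaAlgebra p ⧸ I) = 0 := by
      have := (Ideal.Quotient.eq_zero_iff_mem).2 hgI
      rw [hqdef, map_add, map_pow, hCp, map_natCast] at this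
      exact this
    have hh : (x + 1) ^ k = 1 := by
      have := (Ideal.Quotient.eq_zero_iff_mem).2 hhI
      rw [map_sub, map_pow, map_add, map_one, add_comm] at this
      exact sub_eq_zero.1 this
    have hxk : x ^ k = 0 := pow_prime_pow_eq_zero x s m hm hx hh
    have hXkI : ((PowerSeries.X : IwasawaAlgebra p) ^ k) ∈ I := by
      rw [← Ideal.Quotient.eq_zero_iff_mem, map_pow]
      exact hxk
    have hpI : (PowerSeries.C (p : ℤ_[p]) : IwasawaAlgebra p) ∈ I := by
      have hXm : ((PowerSeries.X : IwasawaAlgebra p) ^ m) = PowerSeries.X ^ (m - k) * PowerSeries.X ^ k := by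
        rw [← pow_add, Nat.sub_add_cancel hm]
      have h2 : (PowerSeries.C (p : ℤ_[p]) : IwasawaAlgebra p) = q - PowerSeries.X ^ (m - k) * PowerSeries.X ^ k := by
        rw [hqdef, hXm]; ring
      rw [h2]
      exact I.sub_mem hgI (I.mul_mem_left _ hXkI)
    rw [Ideal.span_le]
    rintro f hf
    simp only [Set.mem_insert_iff, Set.mem_singleton_iff] at hf
    rcases hf with rfl | rfl
    · exact hpI
    · exact hXkI

/-! ## §2 `#(Λ/(p, T^k)) = p^k` -/

/-- `(p, T^k) = (T^k + p) ⊔ (p^1)` in `Λ` — the ideal of `A_{k,1}`. -/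
theorem lambda_span_C_X_pow_eq_sup (k : ℕ) :
    Ideal.span {PowerSeries.C (p : ℤ_[p]), (PowerSeries.X : IwasawaAlgebra p) ^ k}
      = Ideal.span {(PowerSeries.X ^ k + PowerSeries.C (p : ℤ_[p]) : IwasawaAlgebra p)} ⊔
          Ideal.span {PowerSeries.C ((p : ℤ_[p]) ^ 1)} := by
  rw [pow_one, ← Ideal.span_insert, Ideal.span_pair_add_right, Ideal.span_pair_comm]

/-- **`#(Λ/(p, T^k)) = p^k`** for `k ≥ 1` (it is `#A_{k,1} = p^{1·k}`, tree `card_quotient_span_qm_sup_span_C_pow`). -/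
theorem natCard_lambda_quotient_span_C_X_pow {k : ℕ} (hk : 1 ≤ k) :
    Nat.card (IwasawaAlgebra p ⧸
      Ideal.span {PowerSeries.C (p : ℤ_[p]), (PowerSeries.X : IwasawaAlgebra p) ^ k}) = p ^ k := by
  rw [lambda_span_C_X_pow_eq_sup, IwasawaAlgebra.card_quotient_span_qm_sup_span_C_pow p hk 1, one_mul]

/-! ## §3 `#(Λ/(q_m, (1+T)^{p^s} − 1)) = p^{p^s}` -/

/-- **Eisenstein split control in `Λ`.**  For `p^s ≤ m`: `#(Λ/(T^m + p, (1+T)^{p^s} − 1)) = p^{p^s}`. -/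
theorem natCard_lambda_quotient_eisenstein_split_control (s m : ℕ) (hm : p ^ s ≤ m) :
    Nat.card (IwasawaAlgebra p ⧸
      Ideal.span {(PowerSeries.X ^ m + PowerSeries.C (p : ℤ_[p]) : IwasawaAlgebra p),
        (1 + PowerSeries.X) ^ (p ^ s) - 1}) = p ^ (p ^ s) := by
  rw [lambda_span_qm_pair_eq p s m hm,
    natCard_lambda_quotient_span_C_X_pow p (Nat.one_le_pow _ _ hp.out.pos)]

/-! ## §4 `S_m`-currency: `#(S_m/((1+π)^{p^s} − 1)) = p^{p^s}` -/

/-- The quotient of `S_m = Λ/(q_m)` by `(1+π)^{p^s} − 1` is `Λ/(q_m, (1+T)^{p^s} − 1)` (third isomorphism theorem). -/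
theorem nonempty_specialization_quotient_ringEquiv (s m : ℕ) :
    Nonempty (((IwasawaAlgebra p ⧸ Ideal.span {(PowerSeries.X ^ m + PowerSeries.C (p : ℤ_[p]) : IwasawaAlgebra p)}) ⧸
        Ideal.span {((1 + Ideal.Quotient.mk
          (Ideal.span {(PowerSeries.X ^ m + PowerSeries.C (p : ℤ_[p]) : IwasawaAlgebra p)}) PowerSeries.X)
            ^ (p ^ s) - 1 :
          IwasawaAlgebra p ⧸ Ideal.span {(PowerSeries.X ^ m + PowerSeries.C (p : ℤ_[p]) : IwasawaAlgebra p)})})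
      ≃+* (IwasawaAlgebra p ⧸
        Ideal.span {(PowerSeries.X ^ m + PowerSeries.C (p : ℤ_[p]) : IwasawaAlgebra p),
          (1 + PowerSeries.X) ^ (p ^ s) - 1})) := by
  set q : IwasawaAlgebra p := PowerSeries.X ^ m + PowerSeries.C (p : ℤ_[p]) with hqdef
  set I : Ideal (IwasawaAlgebra p) := Ideal.span {q} with hI
  set J : Ideal (IwasawaAlgebra p) := Ideal.span {((1 + PowerSeries.X) ^ (p ^ s) - 1 : IwasawaAlgebra p)} with hJ
  have hmap : J.map (Ideal.Quotient.mk I)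
      = Ideal.span {((1 + Ideal.Quotient.mk I PowerSeries.X) ^ (p ^ s) - 1 : IwasawaAlgebra p ⧸ I)} := by
    rw [hJ, Ideal.map_span, Set.image_singleton, map_sub, map_pow, map_add, map_one]
  have hsup : I ⊔ J = Ideal.span {q, ((1 + PowerSeries.X) ^ (p ^ s) - 1 : IwasawaAlgebra p)} := by
    rw [hI, hJ, ← Ideal.span_insert]
  exact ⟨(Ideal.quotEquivOfEq hmap.symm).trans ((DoubleQuot.quotQuotEquivQuotSup I J).trans
    (Ideal.quotEquivOfEq hsup))⟩

/-- **Howard's term (iv) at a split multiplicative place, EXACT.**  In `S_m = Λ/(T^m + p)` with `π = [T]` and the universal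
character `Ψ(γ) = 1 + π`: for a decomposition group of index `p^s` in `Γ` and every `m ≥ p^s`,
`#(S_m / (Ψ(γ^{p^s}) − 1)) = #(S_m/((1+π)^{p^s} − 1)) = p^{p^s}` — finite, independent of `m`. -/
theorem natCard_specialization_quotient_onePlusPi_pow_sub_one (s m : ℕ) (hm : p ^ s ≤ m) :
    Nat.card (((IwasawaAlgebra p ⧸ Ideal.span {(PowerSeries.X ^ m + PowerSeries.C (p : ℤ_[p]) : IwasawaAlgebra p)}) ⧸
        Ideal.span {((1 + Ideal.Quotient.mk
          (Ideal.span {(PowerSeries.X ^ m + PowerSeries.C (p : ℤ_[p]) : IwasawaAlgebra p)}) PowerSeries.X)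
            ^ (p ^ s) - 1 :
          IwasawaAlgebra p ⧸ Ideal.span {(PowerSeries.X ^ m + PowerSeries.C (p : ℤ_[p]) : IwasawaAlgebra p)})}))
      = p ^ (p ^ s) := by
  obtain ⟨e⟩ := nonempty_specialization_quotient_ringEquiv p s m
  rw [Nat.card_congr e.toEquiv, natCard_lambda_quotient_eisenstein_split_control p s m hm]

/-! ## §5 `A_{m,k}`-currency: `#(A_{m,k}/((1+T)^{p^s} − 1)) = p^{p^s}` for every `k ≥ 1` -/

/-- For `k ≥ 1` and `p^s ≤ m`, the ideal `(q_m) ⊔ (p^k) ⊔ ((1+T)^{p^s} − 1)` of `Λ` is `(q_m, (1+T)^{p^s} − 1)` (it contains `p`). -/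
theorem lambda_span_qm_sup_C_pow_sup_eq {k : ℕ} (hk : 1 ≤ k) (s m : ℕ) (hm : p ^ s ≤ m) :
    (Ideal.span {(PowerSeries.X ^ m + PowerSeries.C (p : ℤ_[p]) : IwasawaAlgebra p)} ⊔
        Ideal.span {PowerSeries.C ((p : ℤ_[p]) ^ k)}) ⊔
      Ideal.span {((1 + PowerSeries.X) ^ (p ^ s) - 1 : IwasawaAlgebra p)}
      = Ideal.span {(PowerSeries.X ^ m + PowerSeries.C (p : ℤ_[p]) : IwasawaAlgebra p),
          (1 + PowerSeries.X) ^ (p ^ s) - 1} := by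
  have hpair : Ideal.span {(PowerSeries.X ^ m + PowerSeries.C (p : ℤ_[p]) : IwasawaAlgebra p)} ⊔
      Ideal.span {((1 + PowerSeries.X) ^ (p ^ s) - 1 : IwasawaAlgebra p)}
      = Ideal.span {(PowerSeries.X ^ m + PowerSeries.C (p : ℤ_[p]) : IwasawaAlgebra p),
          (1 + PowerSeries.X) ^ (p ^ s) - 1} := by
    rw [← Ideal.span_insert]
  have hpk : (PowerSeries.C ((p : ℤ_[p]) ^ k) : IwasawaAlgebra p) ∈
      Ideal.span {(PowerSeries.X ^ m + PowerSeries.C (p : ℤ_[p]) : IwasawaAlgebra p),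
        (1 + PowerSeries.X) ^ (p ^ s) - 1} := by
    rw [lambda_span_qm_pair_eq p s m hm, map_pow]
    exact Ideal.pow_mem_of_mem _ (Ideal.subset_span (by simp)) _ hk
  rw [sup_right_comm, hpair]
  exact sup_eq_left.2 ((Ideal.span_singleton_le_iff_mem _).2 hpk)

/-- The quotient `A_{m,k}/((1+T)^{p^s} − 1)` is `Λ/(q_m, (1+T)^{p^s} − 1)` for `k ≥ 1`, `p^s ≤ m`. -/
theorem nonempty_eisensteinCoeff_quotient_ringEquiv {k : ℕ} (hk : 1 ≤ k) (s m : ℕ) (hm : p ^ s ≤ m) :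
    Nonempty ((IwasawaAlgebra.EisensteinCoeff p m k ⧸
        Ideal.span {IwasawaAlgebra.EisensteinCoeff.onePlusT p m k ^ (p ^ s) - 1})
      ≃+* (IwasawaAlgebra p ⧸
        Ideal.span {(PowerSeries.X ^ m + PowerSeries.C (p : ℤ_[p]) : IwasawaAlgebra p),
          (1 + PowerSeries.X) ^ (p ^ s) - 1})) := by
  set I₂ : Ideal (IwasawaAlgebra p) :=
    Ideal.span {(PowerSeries.X ^ m + PowerSeries.C (p : ℤ_[p]) : IwasawaAlgebra p)} ⊔
      Ideal.span {PowerSeries.C ((p : ℤ_[p]) ^ k)} with hI₂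
  set J : Ideal (IwasawaAlgebra p) := Ideal.span {((1 + PowerSeries.X) ^ (p ^ s) - 1 : IwasawaAlgebra p)} with hJ
  have hmap : J.map (Ideal.Quotient.mk I₂)
      = Ideal.span {IwasawaAlgebra.EisensteinCoeff.onePlusT p m k ^ (p ^ s) - 1} := by
    rw [hJ, Ideal.map_span, Set.image_singleton, map_sub, map_pow, map_one,
      IwasawaAlgebra.EisensteinCoeff.onePlusT_def]
  exact ⟨(Ideal.quotEquivOfEq hmap.symm).trans ((DoubleQuot.quotQuotEquivQuotSup I₂ J).trans
    (Ideal.quotEquivOfEq (lambda_span_qm_sup_C_pow_sup_eq p hk s m hm)))⟩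

/-- **`#(A_{m,k}/((1+T)^{p^s} − 1)) = p^{p^s}` for every `k ≥ 1` and `m ≥ p^s`** — the equality case `n₀ = 1` (split
multiplicative place: trivial graded character), down to the boundary `m = p^s`, of the tree's anomalous-graded bound
`EisensteinCoeff.natCard_quotient_span_intCast_mul_onePlusT_pow_sub_one_le` (`≤ p^{p^s}`, `p ∤ n₀`, `p^s < m`): uniformly in the
level `k` and in `m`, the invariants term of Howard 2004 Lemma 3.2.7 along the Eisenstein prime `q_m` has order EXACTLY `p^{p^s}`. -/
theorem natCard_eisensteinCoeff_quotient_onePlusT_pow_sub_one {k : ℕ} (hk : 1 ≤ k) (s m : ℕ) (hm : p ^ s ≤ m) :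
    Nat.card (IwasawaAlgebra.EisensteinCoeff p m k ⧸
        Ideal.span {IwasawaAlgebra.EisensteinCoeff.onePlusT p m k ^ (p ^ s) - 1}) = p ^ (p ^ s) := by
  obtain ⟨e⟩ := nonempty_eisensteinCoeff_quotient_ringEquiv p hk s m hm
  rw [Nat.card_congr e.toEquiv, natCard_lambda_quotient_eisenstein_split_control p s m hm]

end Summit.BirchSwinnertonDyer.BirchSwinnertonDyer.Theorems.UniversalToricDescentEisensteinSplitControl

end
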